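import Summits.CriticalPhenomena.PercolationContinuityZ3.Theorems.PercNearOneGluingNoHeavyLowerTailThetaFarRows
import Summits.CriticalPhenomena.PercolationContinuityZ3.Theorems.PercNearOneGluingNoHeavyLowerTailHubPairApexCells
import Summits.CriticalPhenomena.PercolationContinuityZ3.Theorems.PercNearOneGluingNoHeavyLowerTailApexTwoSumTools
import HarnessLib

/-!
# `NoHeavyLowerTail` (stmt-CriticalPhenomena-4575) — R1 ON EVERY Θ-GRAPH: a hub pair splitting the terminals 1|1|1 (every `q > 0`)

Support file (prover prim-gen-kcluster gen 72; `--supports stmt-CriticalPhenomena-4575`).  No definitions, no named facts, no sorries.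
This is KCLUSTER-gen65 Corollary A ("a minimal counterexample to R1-RC has no hub pair `{h₁,h₂}` leaving `a, b, c` in three different
components") as a KERNEL theorem at the measure level: the Θ-identity with an arbitrary far side (`HubPairApex.r1_of_far_side`) fed with the
six far-side rows of two terminal arms in parallel (`ThetaFar.cross_row / w0_row / w1_row / wired_row`, `ApexTwoSum.r1_of_apexTwoSum` at both hubs).

SETTING.  Three edge supports on a finite vertex type: the APEX ARM `DA ∋ a` and the TERMINAL ARMS `DB ∋ b`, `DC ∋ c`, pairwise meeting only in the
hubs `h₁ ≠ h₂`; `a ∉ V(DB ∪ DC)`, `b ∉ V(DA ∪ DC)`, `c ∉ V(DA ∪ DB)`; `c ∈ cl (DB ∪ DC) b` (the far side joins the terminals, automatic for connected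
arms); weights `w` vanishing off `DA ∪ (DB ∪ DC)`, `wA = w·1_{DA}`, `wY = w·1_{DAᶜ}` (far side), `wB = wY·1_{DB}`, `wC = wY·1_{DBᶜ}`.
HYPOTHESES on each terminal arm `X ∈ {B, C}` (terminal `t`; `φ_X = rcMeasureW wX q ∅`): R1 for `(h₁; t, h₂)` and for `(h₂; t, h₁)`, the FKG slack for
`(h₁; t, h₂)` (`φ_X(U_{h₂})(φ_X(U_t) + φ_X(U_{h₁}')) ≤ φ_X(T) φ_X(E)`, automatic for `q ≥ 1`), non-degeneracy `φ_X(t, h₂ ∈ C(h₁)) ≠ 0`.  NOTHING is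
assumed about the apex arm.
**THEOREM** (`ThetaFar.theta_r1`): then R1 holds for `(a; b, c)` on `rcMeasureW w q ∅` with support `D = DA ∪ DB ∪ DC`, every `q > 0`;
`theta_r1_of_one_le`: for `q ≥ 1` the FKG slacks are automatic (`ApexTwoSum.fkg_slack_of_one_le`), leaving R1 at both hubs and non-degeneracy.
-/

noncomputable section

namespace Summit.CriticalPhenomena.PercolationContinuityZ3.Theorems

namespace ThetaFar

open Finset SimpleGraph Literature.Probability.Percolation Literature.Probability.Percolation.Gladkov
open Literature.Probability.Percolation.BHK2006 (weight)
open Literature.Probability.Percolation.DecisionTree (ind ind_of_mem ind_of_not_mem ind_nonneg)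
open Literature.Probability.LatticeModels RefinedRowR3 ThreePointLB APL MeasureTheory
open scoped Classical

variable {V : Type*} [Fintype V]

/-- **R1 on every Θ-graph** (hub pair splitting the terminals 1|1|1; every `q > 0`; see the module docstring). [this work] -/
theorem theta_r1 {DA DB DC D : Finset (Sym2 V)} {a b c h₁ h₂ : V}
    (h12 : h₁ ≠ h₂) (ha1 : a ≠ h₁) (ha2 : a ≠ h₂) (hab : a ≠ b) (hac : a ≠ c) (hbc : b ≠ c)
    (h1b : h₁ ≠ b) (h1c : h₁ ≠ c) (h2b : h₂ ≠ b) (h2c : h₂ ≠ c)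
    (hgAB : ∀ z : V, (∃ e ∈ DA, z ∈ e) → (∃ e ∈ DB, z ∈ e) → (z = h₁ ∨ z = h₂))
    (hgAC : ∀ z : V, (∃ e ∈ DA, z ∈ e) → (∃ e ∈ DC, z ∈ e) → (z = h₁ ∨ z = h₂))
    (hBC : ∀ z : V, (∃ e ∈ DB, z ∈ e) → (∃ e ∈ DC, z ∈ e) → (z = h₁ ∨ z = h₂))
    (haB : ∀ e ∈ DB, a ∉ e) (haC : ∀ e ∈ DC, a ∉ e) (hbA : ∀ e ∈ DA, b ∉ e) (hbC : ∀ e ∈ DC, b ∉ e)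
    (hcA : ∀ e ∈ DA, c ∉ e) (hcB : ∀ e ∈ DB, c ∉ e) (hconn : c ∈ cl (DB ∪ DC) b)
    (hD : ∀ e, e ∈ D ↔ e ∈ DA ∨ e ∈ DB ∪ DC)
    (w wA wY wB wC : Sym2 V → unitInterval) {q : ℝ} (hq : 0 < q)
    (hw : ∀ e, e ∉ (↑DA ∪ ↑(DB ∪ DC) : Set (Sym2 V)) → (w e : ℝ) = 0)
    (hXA : ∀ e ∈ (↑DA : Set (Sym2 V)), wA e = w e) (hXA' : ∀ e ∉ (↑DA : Set (Sym2 V)), wA e = 0)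
    (hY : ∀ e ∈ (↑DA : Set (Sym2 V)), wY e = 0) (hY' : ∀ e ∉ (↑DA : Set (Sym2 V)), wY e = w e)
    (hB : ∀ e ∈ (↑DB : Set (Sym2 V)), wB e = wY e) (hB' : ∀ e ∉ (↑DB : Set (Sym2 V)), wB e = 0)
    (hC : ∀ e ∈ (↑DB : Set (Sym2 V)), wC e = 0) (hC' : ∀ e ∉ (↑DB : Set (Sym2 V)), wC e = wY e)
  (hR1B : (rcMeasureW wB q ∅).real {η : BondConfig V | b ∈ cl η.toFinset h₁ ∧ h₂ ∈ cl η.toFinset h₁} * (rcMeasureW wB q ∅).real {η : BondConfig V | b ∉ cl η.toFinset h₁ ∧ h₂ ∉ cl η.toFinset h₁ ∧ Sep DB (cl η.toFinset h₁) b h₂} ≤ (rcMeasureW wB q ∅).real {η : BondConfig V | b ∈ cl η.toFinset h₁ ∧ h₂ ∉ cl η.toFinset h₁} * (rcMeasureW wB q ∅).real {η : BondConfig V | b ∉ cl η.toFinset h₁ ∧ h₂ ∈ cl η.toFinset h₁}) (hR2B : (rcMeasureW wB q ∅).real {η : BondConfig V | b ∈ cl η.toFinset h₂ ∧ h₁ ∈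 cl η.toFinset h₂} * (rcMeasureW wB q ∅).real {η : BondConfig V | b ∉ cl η.toFinset h₂ ∧ h₁ ∉ cl η.toFinset h₂ ∧ Sep DB (cl η.toFinset h₂) b h₁} ≤ (rcMeasureW wB q ∅).real {η : BondConfig V | b ∈ cl η.toFinset h₂ ∧ h₁ ∉ cl η.toFinset h₂} * (rcMeasureW wB q ∅).real {η : BondConfig V | b ∉ cl η.toFinset h₂ ∧ h₁ ∈ cl η.toFinset h₂})
  (hFB : (rcMeasureW wB q ∅).real {η : BondConfig V | b ∉ cl η.toFinset h₁ ∧ h₂ ∈ cl η.toFinset h₁} * ((rcMeasureW wB q ∅).real {η : BondConfig V | b ∈ cl η.toFinset h₁ ∧ h₂ ∉ cl η.toFinset h₁} + (rcMeasureW wB q ∅).real {η : BondConfig V | b ∉ cl η.toFinset h₁ ∧ h₂ ∉ cl η.toFinset h₁ ∧ h₂ ∈ cl η.toFinset b}) ≤ (rcMeasureW wB q ∅).real {η : BondConfig V | b ∈ cl η.toFinset h₁ ∧ h₂ ∈ cl η.toFinset h₁} * (rcMeasureW wB q ∅).real {η : BondConfig V | b ∉ cl η.toFinset h₁ ∧ h₂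 ∉ cl η.toFinset h₁ ∧ h₂ ∉ cl η.toFinset b}) (hAB : (rcMeasureW wB q ∅).real {η : BondConfig V | b ∈ cl η.toFinset h₁ ∧ h₂ ∈ cl η.toFinset h₁} ≠ 0)
  (hR1C : (rcMeasureW wC q ∅).real {η : BondConfig V | c ∈ cl η.toFinset h₁ ∧ h₂ ∈ cl η.toFinset h₁} * (rcMeasureW wC q ∅).real {η : BondConfig V | c ∉ cl η.toFinset h₁ ∧ h₂ ∉ cl η.toFinset h₁ ∧ Sep DC (cl η.toFinset h₁) c h₂} ≤ (rcMeasureW wC q ∅).real {η : BondConfig V | c ∈ cl η.toFinset h₁ ∧ h₂ ∉ cl η.toFinset h₁} * (rcMeasureW wC q ∅).real {η : BondConfig V | c ∉ cl η.toFinset h₁ ∧ h₂ ∈ cl η.toFinset h₁}) (hR2C : (rcMeasureW wC q ∅).real {η : BondConfig V | c ∈ cl η.toFinset h₂ ∧ h₁ ∈ cl η.toFinset h₂} * (rcMeasureW wC q ∅).real {η : BondConfig V | c ∉ cl η.toFinset h₂ ∧ h₁ ∉ cl η.toFinset h₂ ∧ Sep DC (cl η.toFinset h₂) c h₁} ≤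 (rcMeasureW wC q ∅).real {η : BondConfig V | c ∈ cl η.toFinset h₂ ∧ h₁ ∉ cl η.toFinset h₂} * (rcMeasureW wC q ∅).real {η : BondConfig V | c ∉ cl η.toFinset h₂ ∧ h₁ ∈ cl η.toFinset h₂})
  (hFC : (rcMeasureW wC q ∅).real {η : BondConfig V | c ∉ cl η.toFinset h₁ ∧ h₂ ∈ cl η.toFinset h₁} * ((rcMeasureW wC q ∅).real {η : BondConfig V | c ∈ cl η.toFinset h₁ ∧ h₂ ∉ cl η.toFinset h₁} + (rcMeasureW wC q ∅).real {η : BondConfig V | c ∉ cl η.toFinset h₁ ∧ h₂ ∉ cl η.toFinset h₁ ∧ h₂ ∈ cl η.toFinset c}) ≤ (rcMeasureW wC q ∅).real {η : BondConfig V | c ∈ cl η.toFinset h₁ ∧ h₂ ∈ cl η.toFinset h₁} * (rcMeasureW wC q ∅).real {η : BondConfig V | c ∉ cl η.toFinset h₁ ∧ h₂ ∉ cl η.toFinset h₁ ∧ h₂ ∉ cl η.toFinset c}) (hAC : (rcMeasureW wC q ∅).real {η : BondConfig V | c ∈ cl η.toFinset h₁ ∧ h₂ ∈ cl η.toFinset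 h₁} ≠ 0) :
    (rcMeasureW w q ∅).real {η : BondConfig V | b ∈ cl η.toFinset a ∧ c ∈ cl η.toFinset a} * (rcMeasureW w q ∅).real {η : BondConfig V | b ∉ cl η.toFinset a ∧ c ∉ cl η.toFinset a ∧ Sep D (cl η.toFinset a) b c} ≤ (rcMeasureW w q ∅).real {η : BondConfig V | b ∈ cl η.toFinset a ∧ c ∉ cl η.toFinset a} * (rcMeasureW w q ∅).real {η : BondConfig V | b ∉ cl η.toFinset a ∧ c ∈ cl η.toFinset a} := by
  -- the far side's weights vanish off `DB ∪ DC`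
  have hwY : ∀ e, e ∉ (↑DB ∪ ↑DC : Set (Sym2 V)) → (wY e : ℝ) = 0 := by
    intro e he
    by_cases heA : e ∈ (↑DA : Set (Sym2 V))
    · rw [hY e heA]; rfl
    · rw [hY' e heA]
      exact hw e (fun h => h.elim heA (fun h' => he (by rwa [Finset.coe_union] at h')))
  have hDY : ∀ e, e ∈ DB ∪ DC ↔ e ∈ DB ∨ e ∈ DC := fun e => Finset.mem_union
  have hBC' : ∀ z : V, (∃ e ∈ DB, z ∈ e) → (∃ e ∈ DC, z ∈ e) → (z = h₂ ∨ z = h₁) := fun z h1 h2 => (hBC z h1 h2).symm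
  -- R1 of the far side at the two hubs (2-sum through the apex)
  have hR1 := ApexTwoSum.r1_of_apexTwoSum (a := h₁) (h := h₂) h12 h1b h1c hbc h2b h2c hBC hbC hcB hDY wY wB wC hq hwY hB hB' hC hC'
    hR1B hFB hAB hR1C hFC hAC
  have hFB2 : (rcMeasureW wB q ∅).real {η : BondConfig V | b ∉ cl η.toFinset h₂ ∧ h₁ ∈ cl η.toFinset h₂} * ((rcMeasureW wB q ∅).real {η : BondConfig V | b ∈ cl η.toFinset h₂ ∧ h₁ ∉ cl η.toFinset h₂} + (rcMeasureW wB q ∅).real {η : BondConfig V | b ∉ cl η.toFinset h₂ ∧ h₁ ∉ cl η.toFinset h₂ ∧ h₁ ∈ cl η.toFinset b}) ≤ (rcMeasureW wB q ∅).real {η : BondConfig V | b ∈ cl η.toFinset h₂ ∧ h₁ ∈ cl η.toFinset h₂} * (rcMeasureW wB q ∅).real {η : BondConfig V | b ∉ cl η.toFinset h₂ ∧ h₁ ∉ cl η.toFinset h₂ ∧ h₁ ∉ cl η.toFinset b} := by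
    rw [← cellB_symm b h₁ h₂, ← cellA_symm b h₁ h₂, ← cellE_symm b h₁ h₂, ← cellD_symm b h₁ h₂, ← cellC_symm b h₁ h₂, add_comm]
    exact hFB
  have hFC2 : (rcMeasureW wC q ∅).real {η : BondConfig V | c ∉ cl η.toFinset h₂ ∧ h₁ ∈ cl η.toFinset h₂} * ((rcMeasureW wC q ∅).real {η : BondConfig V | c ∈ cl η.toFinset h₂ ∧ h₁ ∉ cl η.toFinset h₂} + (rcMeasureW wC q ∅).real {η : BondConfig V | c ∉ cl η.toFinset h₂ ∧ h₁ ∉ cl η.toFinset h₂ ∧ h₁ ∈ cl η.toFinset c}) ≤ (rcMeasureW wC q ∅).real {η : BondConfig V | c ∈ cl η.toFinset h₂ ∧ h₁ ∈ cl η.toFinset h₂} * (rcMeasureW wC q ∅).real {η : BondConfig V | c ∉ cl η.toFinset h₂ ∧ h₁ ∉ cl η.toFinset h₂ ∧ h₁ ∉ cl η.toFinset c} := by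
    rw [← cellB_symm c h₁ h₂, ← cellA_symm c h₁ h₂, ← cellE_symm c h₁ h₂, ← cellD_symm c h₁ h₂, ← cellC_symm c h₁ h₂, add_comm]
    exact hFC
  have hAB2 : (rcMeasureW wB q ∅).real {η : BondConfig V | b ∈ cl η.toFinset h₂ ∧ h₁ ∈ cl η.toFinset h₂} ≠ 0 := by rw [← cellA_symm b h₁ h₂]; exact hAB
  have hAC2 : (rcMeasureW wC q ∅).real {η : BondConfig V | c ∈ cl η.toFinset h₂ ∧ h₁ ∈ cl η.toFinset h₂} ≠ 0 := by rw [← cellA_symm c h₁ h₂]; exact hAC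
  have hR2 := ApexTwoSum.r1_of_apexTwoSum (a := h₂) (h := h₁) h12.symm h2b h2c hbc h1b h1c hBC' hbC hcB hDY wY wB wC hq hwY hB hB' hC hC'
    hR2B hFB2 hAB2 hR2C hFC2 hAC2
  have hRw := wired_row h1b h1c hbc h2b h2c hBC hbC hcB wY wB wC hq hwY hB hB' hC hC'
  have hCR := cross_row h12 h1b h1c hbc h2b h2c hBC hbC hcB wY wB wC hq hwY hB hB' hC hC' hR1B hR2B hFB hAB hR1C hR2C hFC hAC
  have hW0 := w0_row h12 h1b h1c hbc h2b h2c hBC hbC hcB wY wB wC hq hwY hB hB' hC hC' hR1B hR2B hFB hAB hR1C hR2C hFC hAC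
  have hW1 := w1_row h12 h1b h1c hbc h2b h2c hBC hbC hcB wY wB wC hq hwY hB hB' hC hC' hR1B hR2B hFB hAB hR1C hR2C hFC hAC
  -- the Θ-identity with the far side `DB ∪ DC`
  refine HubPairApex.r1_of_far_side (DA := DA) (DY := DB ∪ DC) h12 ha1 ha2 hab hac ?_ ?_ ?_ ?_ hconn hD w wA wY hq ?_ hXA hXA' hY hY'
    hR1 hR2 hRw hW0 hW1 hCR
  · rintro z hzA ⟨e, he, hze⟩
    rcases Finset.mem_union.1 he with he | he
    · exact hgAB z hzA ⟨e, he, hze⟩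
    · exact hgAC z hzA ⟨e, he, hze⟩
  · intro e he
    rcases Finset.mem_union.1 he with he | he
    · exact haB e he
    · exact haC e he
  · exact fun e he hbe => absurd hbe (hbA e he)
  · exact fun e he hce => absurd hce (hcA e he)
  · intro e he
    exact hw e (by rwa [Finset.coe_union] at he ⊢)

/-- **R1 on every Θ-graph, `q ≥ 1`**: the FKG slacks are automatic, so only R1 at both hubs and non-degeneracy of the terminal arms are needed. [this work] -/
theorem theta_r1_of_one_le {DA DB DC D : Finset (Sym2 V)} {a b c h₁ h₂ : V}
    (h12 : h₁ ≠ h₂) (ha1 : a ≠ h₁) (ha2 : a ≠ h₂) (hab : a ≠ b) (hac : a ≠ c) (hbc : b ≠ c)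
    (h1b : h₁ ≠ b) (h1c : h₁ ≠ c) (h2b : h₂ ≠ b) (h2c : h₂ ≠ c)
    (hgAB : ∀ z : V, (∃ e ∈ DA, z ∈ e) → (∃ e ∈ DB, z ∈ e) → (z = h₁ ∨ z = h₂))
    (hgAC : ∀ z : V, (∃ e ∈ DA, z ∈ e) → (∃ e ∈ DC, z ∈ e) → (z = h₁ ∨ z = h₂))
    (hBC : ∀ z : V, (∃ e ∈ DB, z ∈ e) → (∃ e ∈ DC, z ∈ e) → (z = h₁ ∨ z = h₂))
    (haB : ∀ e ∈ DB, a ∉ e) (haC : ∀ e ∈ DC, a ∉ e) (hbA : ∀ e ∈ DA, b ∉ e) (hbC : ∀ e ∈ DC, b ∉ e)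
    (hcA : ∀ e ∈ DA, c ∉ e) (hcB : ∀ e ∈ DB, c ∉ e) (hconn : c ∈ cl (DB ∪ DC) b)
    (hD : ∀ e, e ∈ D ↔ e ∈ DA ∨ e ∈ DB ∪ DC)
    (w wA wY wB wC : Sym2 V → unitInterval) {q : ℝ} (hq : 1 ≤ q)
    (hw : ∀ e, e ∉ (↑DA ∪ ↑(DB ∪ DC) : Set (Sym2 V)) → (w e : ℝ) = 0)
    (hXA : ∀ e ∈ (↑DA : Set (Sym2 V)), wA e = w e) (hXA' : ∀ e ∉ (↑DA : Set (Sym2 V)), wA e = 0)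
    (hY : ∀ e ∈ (↑DA : Set (Sym2 V)), wY e = 0) (hY' : ∀ e ∉ (↑DA : Set (Sym2 V)), wY e = w e)
    (hB : ∀ e ∈ (↑DB : Set (Sym2 V)), wB e = wY e) (hB' : ∀ e ∉ (↑DB : Set (Sym2 V)), wB e = 0)
    (hC : ∀ e ∈ (↑DB : Set (Sym2 V)), wC e = 0) (hC' : ∀ e ∉ (↑DB : Set (Sym2 V)), wC e = wY e)
  (hR1B : (rcMeasureW wB q ∅).real {η : BondConfig V | b ∈ cl η.toFinset h₁ ∧ h₂ ∈ cl η.toFinset h₁} * (rcMeasureW wB q ∅).real {η : BondConfig V | b ∉ cl η.toFinset h₁ ∧ h₂ ∉ cl η.toFinset h₁ ∧ Sep DB (cl η.toFinset h₁) b h₂} ≤ (rcMeasureW wB q ∅).real {η : BondConfig V | b ∈ cl η.toFinset h₁ ∧ h₂ ∉ cl η.toFinset h₁} * (rcMeasureW wB q ∅).real {η : BondConfig V | b ∉ cl η.toFinset h₁ ∧ h₂ ∈ cl η.toFinset h₁}) (hR2B : (rcMeasureW wB q ∅).real {η : BondConfig V | b ∈ cl η.toFinset h₂ ∧ h₁ ∈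 cl η.toFinset h₂} * (rcMeasureW wB q ∅).real {η : BondConfig V | b ∉ cl η.toFinset h₂ ∧ h₁ ∉ cl η.toFinset h₂ ∧ Sep DB (cl η.toFinset h₂) b h₁} ≤ (rcMeasureW wB q ∅).real {η : BondConfig V | b ∈ cl η.toFinset h₂ ∧ h₁ ∉ cl η.toFinset h₂} * (rcMeasureW wB q ∅).real {η : BondConfig V | b ∉ cl η.toFinset h₂ ∧ h₁ ∈ cl η.toFinset h₂}) (hAB : (rcMeasureW wB q ∅).real {η : BondConfig V | b ∈ cl η.toFinset h₁ ∧ h₂ ∈ cl η.toFinset h₁} ≠ 0)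
  (hR1C : (rcMeasureW wC q ∅).real {η : BondConfig V | c ∈ cl η.toFinset h₁ ∧ h₂ ∈ cl η.toFinset h₁} * (rcMeasureW wC q ∅).real {η : BondConfig V | c ∉ cl η.toFinset h₁ ∧ h₂ ∉ cl η.toFinset h₁ ∧ Sep DC (cl η.toFinset h₁) c h₂} ≤ (rcMeasureW wC q ∅).real {η : BondConfig V | c ∈ cl η.toFinset h₁ ∧ h₂ ∉ cl η.toFinset h₁} * (rcMeasureW wC q ∅).real {η : BondConfig V | c ∉ cl η.toFinset h₁ ∧ h₂ ∈ cl η.toFinset h₁}) (hR2C : (rcMeasureW wC q ∅).real {η : BondConfig V | c ∈ cl η.toFinset h₂ ∧ h₁ ∈ cl η.toFinset h₂} * (rcMeasureW wC q ∅).real {η : BondConfig V | c ∉ cl η.toFinset h₂ ∧ h₁ ∉ cl η.toFinset h₂ ∧ Sep DC (cl η.toFinset h₂) c h₁} ≤ (rcMeasureW wC q ∅).real {η : BondConfig V | c ∈ cl η.toFinset h₂ ∧ h₁ ∉ cl η.toFinset h₂} * (rcMeasureW wC q ∅).real {η : BondConfig V | c ∉ cl η.toFinset h₂ ∧ h₁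 ∈ cl η.toFinset h₂}) (hAC : (rcMeasureW wC q ∅).real {η : BondConfig V | c ∈ cl η.toFinset h₁ ∧ h₂ ∈ cl η.toFinset h₁} ≠ 0) :
    (rcMeasureW w q ∅).real {η : BondConfig V | b ∈ cl η.toFinset a ∧ c ∈ cl η.toFinset a} * (rcMeasureW w q ∅).real {η : BondConfig V | b ∉ cl η.toFinset a ∧ c ∉ cl η.toFinset a ∧ Sep D (cl η.toFinset a) b c} ≤ (rcMeasureW w q ∅).real {η : BondConfig V | b ∈ cl η.toFinset a ∧ c ∉ cl η.toFinset a} * (rcMeasureW w q ∅).real {η : BondConfig V | b ∉ cl η.toFinset a ∧ c ∈ cl η.toFinset a} :=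
  theta_r1 h12 ha1 ha2 hab hac hbc h1b h1c h2b h2c hgAB hgAC hBC haB haC hbA hbC hcA hcB hconn hD w wA wY wB wC (one_pos.trans_le hq)
    hw hXA hXA' hY hY' hB hB' hC hC' hR1B hR2B (ApexTwoSum.fkg_slack_of_one_le wB hq) hAB hR1C hR2C (ApexTwoSum.fkg_slack_of_one_le wC hq) hAC

end ThetaFar

end Summit.CriticalPhenomena.PercolationContinuityZ3.Theorems
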